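import Literature.NumberTheory.EllipticCurves.Kato2004.IwasawaCohomologyCoeffNewform
import Literature.NumberTheory.EllipticCurves.Kato2004.IwasawaCohomologyExistsProofs
import Literature.NumberTheory.EllipticCurves.GreenbergSelmerCharIdealPrincipalProofs
import Literature.NumberTheory.EllipticCurves.PadicCoeffIntegersFrobeniusData
import Literature.NumberTheory.EllipticCurves.NewformsCoeffFieldHolds
import Literature.NumberTheory.Automorphic.PadicIntermediateFieldUnitBall
import Literature.AlgebraicGeometry.Resolution.CompleteLocalDomainNormalizationPowerSeries
import HarnessLib

/-!
# Kato 2004 (Astérisque 295) §12.2 (12.2.1) / §13.8 with COEFFICIENTS: the pinned Iwasawa cohomology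
# `𝐇¹_Γ(T)` over `A⟦X⟧` EXISTS for every `p`-adic representation `T` with coefficients in an adically
# complete ring `A` with `p` in the ideal of definition — and the discharge of the named fact
# `Kato2004.nonempty_iwasawaH1DataCoeff_newform` (proofs only)

Topic `NumberTheory/EllipticCurves`, sub-directory `Kato2004` (namespace = path), sibling proof file of
`IwasawaCohomologyCoeff.lean` / `IwasawaCohomologyCoeffNewform.lean` (statement files untouched).  Seat
`bsd-wall-tp2-p2x` g20 (prover; INPUTS → UNCONDITIONAL lane on the print leaf K0a = item
stmt-BirchSwinnertonDyer-24114 `KatoIwasawaH1DataCoeffNewformInput` of route `ResidualThetaTransportAtTwo`,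
a conjunct of the registered stub `stub_kzgPrints` of crux RSL_g stmt-BirchSwinnertonDyer-22608;
`--supports stmt-BirchSwinnertonDyer-22608`).

## What is proved

* `IwasawaH1CoeffExists.nonempty_iwasawaH1DataCoeff` — for EVERY commutative coefficient ring `A` which is
  adically complete for an ideal `I ∋ p` (`[IsAdicComplete I A]`, `(p : A) ∈ I`), every continuous
  representation `T : GaloisRep ℚ A M`, every `ℤ_p`-extension `κ` of `ℚ` and every topological generator
  `γ`: the hypothesis structure `IwasawaH1DataCoeff T p κ γ` of `IwasawaCohomologyCoeff.lean` is inhabited.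
* `nonempty_iwasawaH1DataCoeff_newform_holds : nonempty_iwasawaH1DataCoeff_newform` — the `𝒪_λ`-coefficient
  named fact (K0a of the RTT route): `A = 𝒪 = padicCoeffIntegers (Set.range ι)`, the valuation ring of the
  finite extension `ℚ_p(ι K_g)` of `ℚ_p` (`K_g` a number field, `IsNewform0.finiteDimensional_coeffField_holds`),
  a complete discrete valuation ring (`padicCoeffIntegers_eq_unitBall` + the `PadicIntermediateField.unitBall`
  API + Matsumura 8.7/8.15 `isAdicComplete_maximalIdeal_of_module_finite` over `ℤ_p`), `p ∈ 𝔪_𝒪`.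
  The newform / Frobenius / cyclotomicity hypotheses of the fact are NOT used: the construction is
  coefficient-ring algebra plus the `Γ_ℚ`-equivariance of corestriction.

## The construction (verbatim the `ℤ_p`-construction of `IwasawaCohomologyExistsProofs.lean`, Lang
*Cyclotomic Fields I and II* Ch. 5 §1 Thm. 1.1 / Washington Thm. 7.1 and Prop. 7.2, with `ℤ_p ↦ A`)

* `H` := the norm-compatible integral families `(y_n)_n ∈ ∏_n H¹(ℤ_n[1/p], T)` (`IsNormCompatible`);
  `proj n` := the `n`-th coordinate.
* The `A⟦X⟧`-action on the level `H¹(ℚ_n, T)`: `θ_n = conj_γ` satisfies `θ_n^{p^n} = 1` (`γ^{p^n} ∈ Gal(ℚ̄/ℚ_n)`,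
  inner automorphisms act trivially: `conjMap_toLinearMap_pow_eq_one`), so `X ↦ θ_n − 1` kills
  `ω_n = (X+1)^{p^n} − 1`, which is DISTINGUISHED at `I` because `C(p^n, k) ∈ pℤ ⊆ I` for `0 < k < p^n`
  (`isDistinguishedAt_omega`); Weierstrass division over the `I`-adically complete `A` (Mathlib
  `Polynomial.IsDistinguishedAt.algEquivQuotient`: `A[X]/(ω_n) ≅ A⟦X⟧/(ω_n)`) gives the ring homomorphism
  `ψ_n : A⟦X⟧ → End_A(H¹(ℚ_n, T))` with `ψ_n(f) = r(θ_n − 1)` for every polynomial `r ≡ f (mod ω_n)`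
  (`exists_ringHom_of_pow_eq_one`).  No topology on the levels and no finiteness theorem is needed.
* The levelwise actions restrict to `H` (`coresLe_conjMap`, `ω_n ∣ ω_{n+1}`, `conjMap_mem_integralH1` — the
  last one is the tree's, already stated for general coefficients) and satisfy `proj_T_smul` / `proj_C_smul`.

Everything here is proved; no definition, no named fact, no `instance`, no notation, no `sorry`.  HONEST
FRAMING: a CONSTRUCTION fact with no arithmetic content (as the docstring of the named fact announces); it
removes ONE named input (K0a, Kato (12.2.1)/§13.8 existence clause) from the trust base of the RTT route;
Kato's Thm. 12.4 (2) (`thm12_4_newform`, K0b) is NOT touched; BSD is not advanced by it.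

## References

* K. Kato, *p-adic Hodge theory and values of zeta functions of modular forms*, Astérisque 295 (2004):
  §8.2 and Lemma 8.5 (pp. 180–184), §12.2 (12.2.1) (p. 220), §13.8 (p. 228). [Kato2004Asterisque]
* S. Lang, *Cyclotomic Fields I and II*, GTM 121 (1990), Ch. 5 §1 Thm. 1.1. [Lang1990]
* L. C. Washington, *Introduction to Cyclotomic Fields*, 2nd ed. (1997), §7.1, Thm. 7.1, Prop. 7.2.
  [Washington1997]
* H. Matsumura, *Commutative Ring Theory* (1987), Thm. 8.7, Thm. 8.15. [Matsumura1987]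
* J. Neukirch, *Algebraic Number Theory* (1999), Ch. II (4.8). [NeukirchANT1999]
* Tree: `Kato2004/IwasawaCohomologyExistsProofs.lean` (the `ℤ_p` twin, `conjMap_mem_integralH1`),
  `Kato2004/IwasawaCohomologyCoeff.lean` (the pin), `Kato2004/IwasawaCohomologyCoeffNewform.lean` (the fact),
  `GreenbergSelmerCharIdealPrincipalProofs.lean` (`padicCoeffIntegers_eq_unitBall`),
  `Automorphic/PadicIntermediateFieldUnitBall.lean` (`unitBall`), `PadicCoeffIntegersFrobeniusData.lean`
  (`GreenbergSelmer.finiteDimensional_padicCoeffField`), `NewformsCoeffFieldHolds.lean`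
  (`IsNewform0.finiteDimensional_coeffField_holds`),
  `AlgebraicGeometry/Resolution/CompleteLocalDomainNormalizationPowerSeries.lean`
  (`isAdicComplete_maximalIdeal_of_module_finite`).
-/

noncomputable section

open scoped NumberField Pointwise
open CategoryTheory Field IsDedekindDomain Polynomial
open Literature.NumberTheory.GaloisRepresentations Rat.HeightOneSpectrum
open Literature.NumberTheory.EllipticCurves.Kato2004.EulerSystemValues

namespace Literature.NumberTheory.EllipticCurves.Kato2004

namespace IwasawaH1CoeffExists

/-! ## `Λ_A = A⟦X⟧` acting through a finite level: Weierstrass division by `ω_n` over an `I`-adically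
complete coefficient ring `A` with `p ∈ I` -/

section Algebra

variable {A : Type*} [CommRing A] (p : ℕ) [Fact p.Prime]

/-- `(X + 1)^m` is monic of degree `m` (over a nontrivial ring). [folklore] -/
private theorem monic_X_add_one_pow [Nontrivial A] (m : ℕ) :
    ((X + 1 : A[X]) ^ m).Monic ∧ ((X + 1 : A[X]) ^ m).natDegree = m := by
  rw [show (X + 1 : A[X]) = X + C 1 by rw [C_1]]
  exact ⟨(monic_X_add_C 1).pow m,
    by rw [(monic_X_add_C 1).natDegree_pow, natDegree_X_add_C, mul_one]⟩

/-- `ω_m = (X + 1)^m − 1` is monic of degree `m` for `m ≠ 0` (over a nontrivial ring). [folklore] -/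
private theorem monic_omega [Nontrivial A] {m : ℕ} (hm : m ≠ 0) :
    ((X + 1 : A[X]) ^ m - 1).Monic ∧ ((X + 1 : A[X]) ^ m - 1).natDegree = m := by
  obtain ⟨hmon, hdeg⟩ := monic_X_add_one_pow (A := A) m
  have hlt : (1 : A[X]).degree < ((X + 1 : A[X]) ^ m).degree := by
    rw [degree_one, degree_eq_natDegree (Monic.ne_zero hmon), hdeg]
    exact_mod_cast Nat.pos_of_ne_zero hm
  refine ⟨hmon.sub_of_left hlt, ?_⟩
  rw [natDegree_sub_eq_left_of_natDegree_lt
    (by rw [natDegree_one, hdeg]; exact Nat.pos_of_ne_zero hm), hdeg]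

/-- **`ω_n = (X + 1)^{p^n} − 1` is a distinguished polynomial** at every ideal `I ∋ p` of a nontrivial
coefficient ring `A`: monic, constant coefficient `0`, and the other non-leading coefficients `C(p^n, k)`,
`0 < k < p^n`, divisible by `p` (Lang, *Cyclotomic Fields I and II*, Ch. 5 §1; Washington §7.1).
[cite: Lang1990, Ch. 5 §1 (p. 124)] [cite: Washington1997, §7.1] -/
theorem isDistinguishedAt_omega [Nontrivial A] {I : Ideal A} (hp : (p : A) ∈ I) (n : ℕ) :
    ((X + 1 : A[X]) ^ p ^ n - 1).IsDistinguishedAt I := by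
  have hpr : p.Prime := Fact.out
  have hm : p ^ n ≠ 0 := pow_ne_zero n hpr.ne_zero
  obtain ⟨hmon, hdeg⟩ := monic_omega (A := A) hm
  refine ⟨⟨fun {k} hk => ?_⟩, hmon⟩
  rw [hdeg] at hk
  rw [coeff_sub, coeff_X_add_one_pow, coeff_one]
  rcases Nat.eq_zero_or_pos k with rfl | hk0
  · simp
  · rw [if_neg hk0.ne', sub_zero]
    obtain ⟨c, hc⟩ := hpr.dvd_choose_pow hk0.ne' hk.ne
    rw [hc, Nat.cast_mul]
    exact I.mul_mem_right _ hp

omit [Fact p.Prime] in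
/-- `ω_n ∣ ω_{n+1}` in `A[X]` (`(X+1)^{p^{n+1}} − 1 = Y^p − 1`, `Y = (X+1)^{p^n}`). [cite: Lang1990, Ch. 5 §1 Thm. 1.1]
[cite: Washington1997, Thm. 7.1] -/
theorem omega_dvd_omega_succ (n : ℕ) :
    ((X + 1 : A[X]) ^ p ^ n - 1) ∣ ((X + 1 : A[X]) ^ p ^ (n + 1) - 1) := by
  have := sub_dvd_pow_sub_pow ((X + 1 : A[X]) ^ p ^ n) 1 p
  rwa [one_pow, ← pow_mul, ← pow_succ] at this

omit [Fact p.Prime] in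
/-- The ideals `(ω_n) ⊆ A⟦X⟧` decrease: `(ω_{n+1}) ≤ (ω_n)`. [cite: Lang1990, Ch. 5 §1 Thm. 1.1]
[cite: Washington1997, Thm. 7.1] -/
theorem span_omega_succ_le (n : ℕ) :
    Ideal.span {(((X + 1 : A[X]) ^ p ^ (n + 1) - 1 : A[X]) : PowerSeries A)} ≤
      Ideal.span {(((X + 1 : A[X]) ^ p ^ n - 1 : A[X]) : PowerSeries A)} := by
  apply Ideal.span_singleton_le_span_singleton.mpr
  exact map_dvd (Polynomial.coeToPowerSeries.ringHom (R := A)) (omega_dvd_omega_succ p n)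

variable [Nontrivial A] {I : Ideal A} [IsAdicComplete I A] (hp : (p : A) ∈ I)
include hp

/-- **Weierstrass division by `ω_n`** over the `I`-adically complete ring `A` (`p ∈ I`): every power series
`f ∈ A⟦X⟧` is congruent modulo `ω_n` to a polynomial (Washington Prop. 7.2; Mathlib
`Polynomial.IsDistinguishedAt.algEquivQuotient`). [cite: Washington1997, Prop. 7.2] [cite: Lang1990, Ch. 5 §2 Thm. 2.1] -/
theorem exists_polynomial_sub_coe_mem_span (n : ℕ) (f : PowerSeries A) :
    ∃ r : A[X], f - (r : PowerSeries A) ∈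
      Ideal.span {(((X + 1 : A[X]) ^ p ^ n - 1 : A[X]) : PowerSeries A)} := by
  set e := (isDistinguishedAt_omega p hp n).algEquivQuotient with he
  obtain ⟨r, hr⟩ := Ideal.Quotient.mk_surjective (e.symm (Ideal.Quotient.mk _ f))
  refine ⟨r, ?_⟩
  rw [← Ideal.Quotient.mk_eq_mk_iff_sub_mem]
  have h2 : e (Ideal.Quotient.mk _ r) = Ideal.Quotient.mk _ (r : PowerSeries A) := by
    simp [he, Polynomial.IsDistinguishedAt.algEquivQuotient]
  rw [← h2, hr, AlgEquiv.apply_symm_apply]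

omit [Fact p.Prime] [Nontrivial A] [IsAdicComplete I A] hp in
/-- `ω_n(θ − 1) = θ^{p^n} − 1`. [folklore] -/
private theorem aeval_sub_one_omega {M : Type*} [AddCommGroup M] [Module A M] (θ : Module.End A M)
    (n : ℕ) : aeval (θ - 1) ((X + 1 : A[X]) ^ p ^ n - 1) = θ ^ p ^ n - 1 := by
  simp [map_sub, map_pow, map_add, aeval_X, sub_add_cancel]

/-- **The `Λ_A = A⟦X⟧`-action through a finite level.**  If an endomorphism `θ` of an `A`-module `M`
satisfies `θ^{p^n} = 1`, then `X ↦ θ − 1` extends to a ring homomorphism `ψ : A⟦X⟧ → End_A(M)` factoring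
through `A⟦X⟧/(ω_n) ≅ A[X]/(ω_n)` (Weierstrass division by the distinguished `ω_n` over the complete `A`):
`ψ(f) = r(θ − 1)` for every polynomial `r ≡ f (mod ω_n)` (Lang Ch. 5 §1 Thm. 1.1, the `n`-th term of
`Λ ≅ lim← A[X]/(ω_n)`; Washington Thm. 7.1 / Prop. 7.2). [cite: Lang1990, Ch. 5 §1 Thm. 1.1]
[cite: Washington1997, Thm. 7.1 and Prop. 7.2] -/
theorem exists_ringHom_of_pow_eq_one {M : Type*} [AddCommGroup M] [Module A M] (θ : Module.End A M)
    (n : ℕ) (hθ : θ ^ p ^ n = 1) :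
    ∃ ψ : PowerSeries A →+* Module.End A M,
      ∀ (f : PowerSeries A) (r : A[X]),
        f - (r : PowerSeries A) ∈ Ideal.span {(((X + 1 : A[X]) ^ p ^ n - 1 : A[X]) : PowerSeries A)} →
        ψ f = aeval (θ - 1) r := by
  set ω : A[X] := (X + 1 : A[X]) ^ p ^ n - 1 with hω
  set e := (isDistinguishedAt_omega p hp n).algEquivQuotient with he
  have hkill : ∀ a ∈ Ideal.span {ω}, (aeval (θ - 1) : A[X] →ₐ[A] Module.End A M) a = 0 := fun a ha ↦ by
    obtain ⟨b, rfl⟩ := Ideal.mem_span_singleton'.mp ha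
    rw [map_mul, hω, aeval_sub_one_omega, hθ, sub_self, mul_zero]
  let L : A[X] ⧸ Ideal.span {ω} →+* Module.End A M :=
    Ideal.Quotient.lift (Ideal.span {ω}) (aeval (θ - 1)).toRingHom hkill
  refine ⟨(L.comp e.symm.toRingEquiv.toRingHom).comp (Ideal.Quotient.mk _), fun f r hfr => ?_⟩
  have h1 : Ideal.Quotient.mk (Ideal.span {(ω : PowerSeries A)}) f =
      Ideal.Quotient.mk _ (r : PowerSeries A) :=
    (Ideal.Quotient.mk_eq_mk_iff_sub_mem _ _).mpr hfr
  have h2 : e (Ideal.Quotient.mk _ r) = Ideal.Quotient.mk _ (r : PowerSeries A) := by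
    simp [he, Polynomial.IsDistinguishedAt.algEquivQuotient]
  rw [RingHom.comp_apply, RingHom.comp_apply, h1, ← h2]
  change L (e.symm (e (Ideal.Quotient.mk _ r))) = _
  rw [AlgEquiv.symm_apply_apply]
  exact Ideal.Quotient.lift_mk _ _ _

omit [Nontrivial A] [IsAdicComplete I A] hp in
/-- A linear map intertwining two endomorphisms intertwines the polynomials in them. [folklore] -/
private theorem map_aeval_apply_of_comp_eq {M M' : Type*} [AddCommGroup M] [Module A M]
    [AddCommGroup M'] [Module A M'] (g : M →ₗ[A] M') (a : Module.End A M) (b : Module.End A M')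
    (h : g ∘ₗ a = b ∘ₗ g) (r : A[X]) (m : M) : g (aeval a r m) = aeval b r (g m) := by
  induction r using Polynomial.induction_on generalizing m with
  | C c => simp
  | add f₁ f₂ h₁ h₂ => simp [h₁, h₂]
  | monomial k c hk =>
    have hc : ∀ m, g (a m) = b (g m) := fun m => by simpa using LinearMap.congr_fun h m
    rw [pow_succ, ← mul_assoc]
    conv_rhs => rw [map_mul, Module.End.mul_apply, aeval_X]
    conv_lhs => rw [map_mul, Module.End.mul_apply, aeval_X]
    rw [hk, hc]

end Algebra

/-! ## Assembly: the datum `IwasawaH1DataCoeff T p κ γ` on the norm-compatible integral families -/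

section Assembly

variable {A : Type} [CommRing A] [TopologicalSpace A] {M : Type} [AddCommGroup M] [Module A M]
  [TopologicalSpace M] [IsTopologicalAddGroup M] [ContinuousSMul A M]
  (T : GaloisRep ℚ A M) (p : ℕ) [Fact p.Prime] (κ : ZpExtension ℚ p)

/-- `γ^{pⁿ} ∈ κ⁻¹(pⁿℤ_p) = Gal(ℚ̄/ℚ_n)` for a topological generator `γ` (local copy, as in the `ℤ_p`
twin). [folklore] -/
private theorem pow_mem_layerSubgroup' {γ : absoluteGaloisGroup ℚ} (hγ : κ.IsTopGenerator γ) (n : ℕ) :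
    γ ^ p ^ n ∈ κ.layerSubgroup n := by
  have hγ' : κ γ = Multiplicative.ofAdd 1 := hγ
  rw [ZpExtension.mem_layerSubgroup, map_pow, hγ', ← ofAdd_nsmul, toAdd_ofAdd, nsmul_eq_mul,
    mul_one, Nat.cast_pow]

/-- The trace map `Cor : H¹(ℚ_{n+1}, T) → H¹(ℚ_n, T)` commutes with the action of `Γ_ℚ` (`coresLe_conjMap`
for the normal layers `Γ_{n+1} ≤ Γ_n`; general coefficients). [cite: Kato2004Asterisque, §12.2 (p. 220)] -/
theorem layerCores_conjMap (n : ℕ) (g : absoluteGaloisGroup ℚ) (y : H1 T (κ.layerSubgroup (n + 1))) :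
    layerCores T κ n (conjMap T.toTopRep (κ.layerSubgroup (n + 1)) g 1 y) =
      conjMap T.toTopRep (κ.layerSubgroup n) g 1 (layerCores T κ n y) := by
  letI : (κ.layerSubgroup (n + 1)).FiniteIndex :=
    finiteIndex_of_isOpen_of_compactSpace _ (κ.isOpen_layerSubgroup (n + 1))
  letI : Fintype (κ.layerSubgroup n ⧸ (κ.layerSubgroup (n + 1)).subgroupOf (κ.layerSubgroup n)) :=
    Fintype.ofFinite _
  have h := coresLe_conjMap T.toTopRep (κ.layerSubgroup_antitone (Nat.le_succ n))
    (κ.isOpen_layerSubgroup (n + 1)) g y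
  unfold layerCores
  convert h using 2

/-- **Kato 2004 §12.2 (12.2.1) / §13.8 with coefficients: the pinned Iwasawa cohomology `𝐇¹_Γ(T)` EXISTS
as an `A⟦X⟧`-module, for every continuous `Γ_ℚ`-representation `T` with coefficients in a nontrivial ring
`A` which is `I`-adically complete for an ideal `I ∋ p`, every `ℤ_p`-extension `κ` and every topological
generator `γ`.**  Construction: `H` = the norm-compatible integral families `(y_n)_n ∈ ∏_n H¹(ℤ_n[1/p], T)`,
`proj n` the `n`-th coordinate; on the `n`-th level `A⟦X⟧` acts through `A⟦X⟧/(ω_n) ≅ A[X]/(ω_n)`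
(Weierstrass division by the distinguished `ω_n = (X+1)^{p^n} − 1`; Lang Ch. 5 Thm. 1.1), `X ↦ conj_γ − 1`,
well defined because `γ^{p^n} ∈ Gal(ℚ̄/ℚ_n)` acts trivially on `H¹(ℚ_n, T)`; the levelwise actions commute
with the trace maps (`coresLe_conjMap`) and preserve integrality (`conjMap_mem_integralH1`).
[cite: Kato2004Asterisque, §12.2 (12.2.1) (p. 220) and §13.8 (p. 228)] [cite: Lang1990, Ch. 5 §1 Thm. 1.1] -/
theorem nonempty_iwasawaH1DataCoeff [Nontrivial A] {I : Ideal A} [IsAdicComplete I A] (hp : (p : A) ∈ I)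
    {γ : absoluteGaloisGroup ℚ} (hγ : κ.IsTopGenerator γ) : Nonempty (IwasawaH1DataCoeff T p κ γ) := by
  -- the level operators `θ_n = conj_γ` on `H¹(ℚ_n, T)` and `θ_n^{p^n} = 1`
  let θ : ∀ n, Module.End A (H1 T (κ.layerSubgroup n)) := fun n ↦
    (conjMap T.toTopRep (κ.layerSubgroup n) γ 1).hom.toLinearMap
  have hθ : ∀ n (c : H1 T (κ.layerSubgroup n)), θ n c = conjMap T.toTopRep (κ.layerSubgroup n) γ 1 c :=
    fun _ _ ↦ rfl
  have hθpow : ∀ n, θ n ^ p ^ n = 1 := fun n ↦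
    conjMap_toLinearMap_pow_eq_one T.toTopRep (κ.layerSubgroup n) (pow_mem_layerSubgroup' p κ hγ n)
  -- the `Λ_A`-action on each level through `A⟦X⟧/(ω_n) ≅ A[X]/(ω_n)`
  choose ψ hψ using fun n ↦ exists_ringHom_of_pow_eq_one p hp (θ n) n (hθpow n)
  letI inst : ∀ n, Module (PowerSeries A) (H1 T (κ.layerSubgroup n)) := fun n ↦ Module.compHom _ (ψ n)
  have smul_def : ∀ (n : ℕ) (f : PowerSeries A) (m : H1 T (κ.layerSubgroup n)), f • m = ψ n f m :=
    fun _ _ _ ↦ rfl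
  -- value of the action on polynomials, on `X`, on constants
  have hψcoe : ∀ (n : ℕ) (r : A[X]), ψ n (r : PowerSeries A) = aeval (θ n - 1) r :=
    fun n r ↦ hψ n _ r (by rw [sub_self]; exact Submodule.zero_mem _)
  have hψX : ∀ n, ψ n (PowerSeries.X : PowerSeries A) = θ n - 1 := fun n ↦ by
    rw [← Polynomial.coe_X, hψcoe, aeval_X]
  have hψC : ∀ (n : ℕ) (c : A), ψ n (PowerSeries.C c : PowerSeries A) = algebraMap A _ c := fun n c ↦ by
    rw [← Polynomial.coe_C, hψcoe, aeval_C]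
  -- `integralH1` is stable under `θ_n - 1`, hence under the action
  have hstable : ∀ n, integralH1 T p (κ.layerSubgroup n) ≤
      (integralH1 T p (κ.layerSubgroup n)).comap (θ n - 1) := by
    intro n m hm
    rw [Submodule.mem_comap, LinearMap.sub_apply, Module.End.one_apply, hθ]
    exact Submodule.sub_mem _ (IwasawaH1Exists.conjMap_mem_integralH1 T p _ γ hm) hm
  -- compatibility of `θ_n − 1` with the trace maps
  have hcomm : ∀ n, (layerCores T κ n) ∘ₗ (θ (n + 1) - 1) = (θ n - 1) ∘ₗ (layerCores T κ n) := by
    intro n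
    refine LinearMap.ext fun y ↦ ?_
    simp only [LinearMap.coe_comp, Function.comp_apply, LinearMap.sub_apply, Module.End.one_apply,
      map_sub, hθ, layerCores_conjMap]
  -- the `Λ_A`-submodule of norm-compatible integral families
  let N : Submodule (PowerSeries A) (∀ n : ℕ, H1 T (κ.layerSubgroup n)) :=
    { carrier := {y | IsNormCompatible T κ y}
      zero_mem' := (normCompatible T κ).zero_mem
      add_mem' := fun ha hb ↦ (normCompatible T κ).add_mem ha hb
      smul_mem' := fun f y hy ↦ by
        refine ⟨fun n ↦ ?_, fun n ↦ ?_⟩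
        · obtain ⟨r, hr⟩ := exists_polynomial_sub_coe_mem_span p hp n f
          rw [Pi.smul_apply, smul_def, hψ n f r hr]
          exact aeval_apply_smul_mem_of_le_comap (hy.1 n) r _ (hstable n)
        · obtain ⟨r, hr⟩ := exists_polynomial_sub_coe_mem_span p hp (n + 1) f
          rw [Pi.smul_apply, Pi.smul_apply, smul_def, smul_def, hψ (n + 1) f r hr,
            hψ n f r (span_omega_succ_le p n hr), map_aeval_apply_of_comp_eq _ _ _ (hcomm n), hy.2 n] }
  refine ⟨{
    H := N
    proj := fun n ↦
      { toFun := fun x ↦ (x : ∀ n : ℕ, H1 T (κ.layerSubgroup n)) n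
        map_zero' := rfl
        map_add' := fun _ _ ↦ rfl }
    proj_mem := fun n x ↦ x.2.1 n
    cores_proj := fun n x ↦ x.2.2 n
    proj_injective := fun x hx ↦ Subtype.ext (funext hx)
    proj_surjective := fun y hy ↦ ⟨⟨y, hy⟩, fun _ ↦ rfl⟩
    proj_T_smul := fun n x ↦ ?_
    proj_C_smul := fun c n x ↦ ?_ }⟩
  · change ψ n PowerSeries.X ((x : ∀ n : ℕ, H1 T (κ.layerSubgroup n)) n) = _
    rw [hψX, LinearMap.sub_apply, Module.End.one_apply, hθ]
    rfl
  · change ψ n (PowerSeries.C c) ((x : ∀ n : ℕ, H1 T (κ.layerSubgroup n)) n) = _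
    rw [hψC, Module.algebraMap_end_apply]
    rfl

end Assembly

/-! ## The coefficient ring `𝒪 = padicCoeffIntegers S` of a finite `ℚ_p(S)/ℚ_p`: a complete DVR with `p ∈ 𝔪` -/

section Integers

open Literature.NumberTheory.Automorphic

variable (p : ℕ) [Fact p.Prime] (S : Set (PadicAlgCl p))

/-- `p ∈ 𝔪_𝒪` for `𝒪 = padicCoeffIntegers S` (`|p|_p < 1`; transported from `PadicIntermediateField.unitBall`
along `padicCoeffIntegers_eq_unitBall`). [cite: NeukirchANT1999, Ch. II (4.8)] -/
theorem natCast_mem_maximalIdeal_padicCoeffIntegers [IsLocalRing (padicCoeffIntegers S)] :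
    ((p : ℕ) : padicCoeffIntegers S) ∈ IsLocalRing.maximalIdeal (padicCoeffIntegers S) := by
  rw [IsLocalRing.mem_maximalIdeal, mem_nonunits_iff]
  have h := padicCoeffIntegers_eq_unitBall (p := p) S
  intro hu
  apply PadicIntermediateField.not_isUnit_natCast_prime p (padicCoeffField S)
  obtain ⟨u, hu'⟩ := hu
  refine ⟨⟨⟨(u : padicCoeffIntegers S).1, h ▸ (u : padicCoeffIntegers S).2⟩,
    ⟨(↑u⁻¹ : padicCoeffIntegers S).1, h ▸ (↑u⁻¹ : padicCoeffIntegers S).2⟩, ?_, ?_⟩, ?_⟩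
  · exact Subtype.ext (congr_arg Subtype.val u.mul_inv)
  · exact Subtype.ext (congr_arg Subtype.val u.inv_mul)
  · exact Subtype.ext (congr_arg Subtype.val hu')

/-- **`𝒪 = padicCoeffIntegers S` is `𝔪`-adically complete** when `ℚ_p(S)/ℚ_p` is finite: `𝒪` is the unit ball
of `ℚ_p(S)` (`padicCoeffIntegers_eq_unitBall`), a local ring module-finite over the complete Noetherian local
ring `ℤ_p` (`PadicIntermediateField.moduleFinite_unitBall`), hence complete (Matsumura Thm. 8.7 / 8.15,
`isAdicComplete_maximalIdeal_of_module_finite`). [cite: Matsumura1987, Thm. 8.7 and Thm. 8.15]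
[cite: NeukirchANT1999, Ch. II (4.8)] -/
theorem isAdicComplete_maximalIdeal_padicCoeffIntegers [FiniteDimensional ℚ_[p] (padicCoeffField S)]
    [IsLocalRing (padicCoeffIntegers S)] :
    IsAdicComplete (IsLocalRing.maximalIdeal (padicCoeffIntegers S)) (padicCoeffIntegers S) := by
  have key : ∀ (R : Subring (PadicAlgCl p)) [IsLocalRing R],
      R = PadicIntermediateField.unitBall p (padicCoeffField S) →
        IsAdicComplete (IsLocalRing.maximalIdeal R) R := by
    rintro R _ rfl
    exact Literature.AlgebraicGeometry.Resolution.isAdicComplete_maximalIdeal_of_module_finite ℤ_[p]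
      (PadicIntermediateField.unitBall p (padicCoeffField S))
  exact key _ (padicCoeffIntegers_eq_unitBall S)

end Integers

end IwasawaH1CoeffExists

/-- **Kato 2004 §12.2 (12.2.1) with §13.8: `𝐇¹_Γ(T_ρ)` exists for the lattice of an integral `p`-adic model
of a weight-`2` newform with `𝒪_λ`-coefficients** — the `_holds` companion of the named fact
`nonempty_iwasawaH1DataCoeff_newform` (K0a of route `ResidualThetaTransportAtTwo`), by
`IwasawaH1CoeffExists.nonempty_iwasawaH1DataCoeff` over the complete discrete valuation ring
`𝒪 = padicCoeffIntegers (Set.range ι)` (`ℚ_p(ι K_g)/ℚ_p` finite since `K_g` is a number field).  The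
newform, Frobenius and cyclotomicity hypotheses are not used by the construction.
[cite: Kato2004Asterisque, §12.2 (12.2.1) (p. 220) and §13.8 (p. 228)] [cite: Lang1990, Ch. 5 §1 Thm. 1.1] -/
theorem nonempty_iwasawaH1DataCoeff_newform_holds : nonempty_iwasawaH1DataCoeff_newform := by
  intro p _ M _ g ι ρ κ γ hg _hρ _hκ hγ
  haveI : FiniteDimensional ℚ (ModularForms.coeffField g) :=
    ModularForms.IsNewform0.finiteDimensional_coeffField_holds hg
  haveI : FiniteDimensional ℚ_[p] (padicCoeffField (Set.range ι)) :=
    GreenbergSelmer.finiteDimensional_padicCoeffField ι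
  haveI : IsLocalRing (padicCoeffIntegers (Set.range ι)) := isLocalRing_padicCoeffIntegers _
  haveI := IwasawaH1CoeffExists.isAdicComplete_maximalIdeal_padicCoeffIntegers p (Set.range ι)
  exact IwasawaH1CoeffExists.nonempty_iwasawaH1DataCoeff ρ.toGaloisRep p κ
    (IwasawaH1CoeffExists.natCast_mem_maximalIdeal_padicCoeffIntegers p (Set.range ι)) hγ

end Literature.NumberTheory.EllipticCurves.Kato2004

end
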